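import Literature.NumberTheory.EllipticCurves.KramerCurves
import Literature.NumberTheory.EllipticCurves.ShaIsogenyProofs
import Literature.NumberTheory.EllipticCurves.IsogenyTwoPowerQuotientProofs
import Literature.NumberTheory.EllipticCurves.IsogenyVariableChangeProofs
import HarnessLib

/-!
# `Ш[n]` along an isogeny of degree prime to `n`; Kramer's `2`-isogeny `A → B`

Everything in this file is proved. For Weierstrass curves over a number field `K` it records,
on the tree's Tate–Shafarevich groups (`WeierstrassCurve.sha ⊆ H¹(K, E)`, file `Sha`) and their
`n`-torsion `Ш(E/K)[n] = E.sha ⊓ E.galH1[n]` (the spelling of `KramerCurves`,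
`Literature.NumberTheory.EllipticCurves.selmer_exact`, and the barrier file
`Literature/Barriers/BirchSwinnertonDyer/DescentDefectUnbounded.lean`):

* `exists_shaTorsion_injective_of_comp_eq_smul`: for an isogeny `f : E → E'` and a
  `Γ_K`-equivariant `g : E'(K̄) → E(K̄)` with `g ∘ f = [d]`, and `n` prime to `d`, the map
  `Ш(f)` (`Literature.NumberTheory.EllipticCurves.shaMap`, unconditional since
  `Isogeny.hasLocalPointsMaps_toAddMonoidHom`, file `ShaIsogenyProofs`) restricts to an INJECTIVE
  homomorphism `Ш(E/K)[n] → Ш(E'/K)[n]` (its kernel is killed by `d`,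
  `ker_shaMap_le_torsionBy`, and by `n`). With the dual isogeny (`g = f̂`, `d = deg f`) this is
  the standard "an isogeny of degree prime to `n` induces an isomorphism on `Ш[n]`" in the
  injective direction — K. Matsuno, Math. Res. Lett. 16 (2009), p. 459: "The isogeny `f : A → B`
  induces an isomorphism `Ш(A/K)[n] ≅ Ш(B/K)[n]` since the degree of `f` is prime to `n`."
* `exists_shaTorsion_injective_smul`, `exists_shaTorsion_injective_of_smul`: `Ш(W)[n] ↪ Ш(C • W)[n]`
  and back, for an admissible change of variables `C` (`VariableChange.toIsogeny`, `d = 1`).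
* `exists_shaTorsion_injective_twoIsogeny`: `Ш(E₁)[n] ↪ Ш(E₂)[n]` for odd `n` along Silverman's
  `2`-isogeny of a curve `E₁ : y² = x³ + ax² + bx` in two-torsion normal form
  (`WeierstrassCurve.twoIsogeny`, with `φ' ∘ φ = [2]` from
  `exists_isogeny_twoIsogeny_comp_eq_two_nsmul`, file `IsogenyTwoPowerQuotientProofs`).
* **Kramer's `2`-isogeny `A → B`** (K. Kramer, Proc. AMS 89 (1983), §5 (11)–(12): `B` is the
  quotient of `A : y² + xy = x³ + 8m x² + m(16m+1) x` by `⟨(0,0)⟩`), realised through explicit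
  models: `(1, 0, −½, 0) • A = A' : y² = x³ + (8m + ¼)x² + m(16m+1)x`
  (`smul_kramerCurveA_eq`), `E₂(A') : Y² = X³ − (16m + ½)X² + X/16`
  (`twoIsogenyCodomain_kramerCurveA_nf`), and `(1, −¼, −½, ⅛) • B = E₂(A')` (`smul_kramerCurveB_eq`,
  moving the rational `2`-torsion point `(−¼, ⅛)` of `B`, Kramer Lemma 3, to the origin). Hence
  `Ш(A/K)[n] ↪ Ш(B/K)[n]` for odd `n` over any number field
  (`exists_shaTorsion_injective_kramerCurveA_to_B`), and for the base changes to `K` of the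
  curves over `ℚ` (`exists_shaTorsion_injective_kramer_baseChange`) — the transfer step of the
  proof of Matsuno's Theorem 5.1 (consumed by
  `Literature/Barriers/BirchSwinnertonDyer/DescentDefectUnboundedMatsunoThm51Proofs.lean`).

## References

* K. Matsuno, *Elliptic curves with large Tate–Shafarevich groups over a number field*, Math.
  Res. Lett. 16 (2009), 449–461, §5 (p. 459). [Matsuno2009]
* K. Kramer, *A family of semistable elliptic curves with large Tate–Shafarevitch groups*, Proc.
  Amer. Math. Soc. 89 (1983), 379–386: §3 (6), §5 (11)–(12), Lemma 3. [Kramer1983]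
* J. H. Silverman, *The Arithmetic of Elliptic Curves*, 2nd ed. (2009): III.1 Table 3.1,
  III.4 Example 4.5, Thm. III.6.1(a). [SilvermanAEC2009]
* J. S. Milne, *Arithmetic Duality Theorems*, 2nd ed. (2006), I.§7 (proof of Lemma 7.1: `Ш(f)`
  and its kernel), through `ShaIsogeny`. [MilneADT2006]
-/

noncomputable section

open scoped Classical

open WeierstrassCurve

universe u

namespace Literature.NumberTheory.EllipticCurves

/-! ### `Ш[n]` along an isogeny of degree prime to `n` -/

section Transfer

variable {K : Type u} [Field K] [NumberField K]

/-- An element of an abelian group killed by two coprime natural numbers is zero (its order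
divides `gcd(a, b) = 1`). [folklore] -/
theorem eq_zero_of_nsmul_eq_zero_of_coprime {M : Type*} [AddCommGroup M] {a b : ℕ}
    (hab : a.Coprime b) {x : M} (ha : a • x = 0) (hb : b • x = 0) : x = 0 := by
  have h1 : addOrderOf x ∣ 1 := by
    rw [← hab]
    exact Nat.dvd_gcd (addOrderOf_dvd_of_nsmul_eq_zero ha) (addOrderOf_dvd_of_nsmul_eq_zero hb)
  exact AddMonoid.addOrderOf_eq_one_iff.mp (Nat.dvd_one.mp h1)

/-- **`Ш(E/K)[n] ↪ Ш(E'/K)[n]` along `f` when `g ∘ f = [d]` with `(n, d) = 1`.** For an isogeny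
`f : E → E'` over a number field and a `Γ_K`-equivariant homomorphism `g : E'(K̄) → E(K̄)` with
`g ∘ f = [d]`, the map `Ш(f)` (`Literature.NumberTheory.EllipticCurves.shaMap`, unconditional by
`Isogeny.hasLocalPointsMaps_toAddMonoidHom`) restricts to an injection of the `n`-torsion
subgroups for every `n` prime to `d`: an element of its kernel is killed by `d`
(`ker_shaMap_le_torsionBy`) and by `n`, hence is `0`. (Matsuno, p. 459: "The isogeny `f : A → B`
induces an isomorphism `Ш(A/K)[n] ≅ Ш(B/K)[n]` since the degree of `f` is prime to `n`"; only
the injection, which is what the proof of Theorem 5.1 uses, is recorded.)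
[cite: Matsuno2009, §5 (p. 459)] -/
theorem exists_shaTorsion_injective_of_comp_eq_smul {W W' : WeierstrassCurve K}
    (f : Isogeny W W') (g : W'.geomPoints →+ W.geomPoints)
    (hg : ∀ (σ : Field.absoluteGaloisGroup K) (Q : W'.geomPoints), g (σ • Q) = σ • g Q)
    {d : ℕ} (hgf : ∀ P : W.geomPoints, g (f P) = (d : ℤ) • P) {n : ℕ} (hnd : n.Coprime d) :
    ∃ F : ↥(W.sha ⊓ AddSubgroup.torsionBy W.galH1 n) →+
        ↥(W'.sha ⊓ AddSubgroup.torsionBy W'.galH1 n), Function.Injective F := by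
  have hloc := f.hasLocalPointsMaps_toAddMonoidHom
  set S : W.sha →+ W'.sha := shaMap f.toAddMonoidHom f.equivariant hloc with hS
  have hker : S.ker ≤ AddSubgroup.torsionBy W.sha (d : ℤ) :=
    ker_shaMap_le_torsionBy f.toAddMonoidHom f.equivariant hloc g hg hgf
  let ι : ↥(W.sha ⊓ AddSubgroup.torsionBy W.galH1 n) →+ W.sha :=
    AddSubgroup.inclusion inf_le_left
  have hmem : ∀ x : ↥(W.sha ⊓ AddSubgroup.torsionBy W.galH1 n),
      ((S (ι x) : W'.sha) : W'.galH1) ∈ W'.sha ⊓ AddSubgroup.torsionBy W'.galH1 n := by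
    intro x
    refine ⟨(S (ι x)).2, AddSubgroup.torsionBy.nsmul_iff.mpr ?_⟩
    have hx : n • x = 0 := Subtype.ext (AddSubgroup.torsionBy.nsmul_iff.mp x.2.2)
    rw [← AddSubgroup.coe_nsmul, ← map_nsmul, ← map_nsmul, hx, map_zero, map_zero,
      AddSubgroup.coe_zero]
  refine ⟨(W'.sha.subtype.comp (S.comp ι)).codRestrict _ hmem, ?_⟩
  rw [injective_iff_map_eq_zero]
  intro x hx
  have hx0 : n • x = 0 := Subtype.ext (AddSubgroup.torsionBy.nsmul_iff.mp x.2.2)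
  have h1 : S (ι x) = 0 := by
    have hx' := congrArg Subtype.val hx
    apply Subtype.ext
    exact hx'
  have h2 : ι x ∈ AddSubgroup.torsionBy W.sha (d : ℤ) := hker h1
  have hd : d • ι x = 0 := AddSubgroup.torsionBy.nsmul_iff.mp h2
  have hn : n • ι x = 0 := by rw [← map_nsmul, hx0, map_zero]
  have h3 : ι x = 0 := eq_zero_of_nsmul_eq_zero_of_coprime hnd hn hd
  exact (AddSubgroup.inclusion_injective inf_le_left) (h3.trans (map_zero ι).symm)

/-- **`Ш(W)[n] ↪ Ш(C • W)[n]`** for an admissible change of variables `C` over `K` (an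
isomorphism of curves; `g` = the inverse substitution on `K̄`-points, `g ∘ f = id = [1]`).
[folklore] -/
theorem exists_shaTorsion_injective_smul (W : WeierstrassCurve K) (C : VariableChange K)
    (n : ℕ) :
    ∃ F : ↥(W.sha ⊓ AddSubgroup.torsionBy W.galH1 n) →+
        ↥((C • W).sha ⊓ AddSubgroup.torsionBy (C • W).galH1 n), Function.Injective F := by
  refine exists_shaTorsion_injective_of_comp_eq_smul (VariableChange.toIsogeny W C)
    (VariableChange.pointEquivBaseChange W C (AlgebraicClosure K)).symm.toAddMonoidHom
    (fun σ Q => ?_) (d := 1) (fun P => ?_) (Nat.coprime_one_right n)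
  · exact (VariableChange.pointEquivBaseChange_symm_map W C
      ((show AlgebraicClosure K ≃ₐ[K] AlgebraicClosure K from σ) :
        AlgebraicClosure K →ₐ[K] AlgebraicClosure K) Q).symm
  · rw [Nat.cast_one, one_zsmul]
    exact (VariableChange.pointEquivBaseChange W C (AlgebraicClosure K)).symm_apply_apply P

/-- **`Ш(C • W)[n] ↪ Ш(W)[n]`** (the inverse change of variables `C⁻¹ : C • W → W`). [folklore] -/
theorem exists_shaTorsion_injective_of_smul (W : WeierstrassCurve K) (C : VariableChange K)
    (n : ℕ) :
    ∃ F : ↥((C • W).sha ⊓ AddSubgroup.torsionBy (C • W).galH1 n) →+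
        ↥(W.sha ⊓ AddSubgroup.torsionBy W.galH1 n), Function.Injective F := by
  have h := exists_shaTorsion_injective_smul (C • W) C⁻¹ n
  rwa [inv_smul_smul] at h

/-- **`Ш(E₁)[n] ↪ Ш(E₂)[n]` along Silverman's `2`-isogeny** `φ : E₁ : y² = x³ + ax² + bx → E₂`
(`WeierstrassCurve.twoIsogeny`) over a number field, for odd `n`: the dual `2`-isogeny `φ'`
satisfies `φ' ∘ φ = [2]` (`exists_isogeny_twoIsogeny_comp_eq_two_nsmul`) and `(n, 2) = 1`.
[cite: SilvermanAEC2009, III.4 Example 4.5 and Thm. III.6.1(a)] -/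
theorem exists_shaTorsion_injective_twoIsogeny (W : WeierstrassCurve K) [W.IsTwoTorsionNF]
    [W.IsElliptic] {n : ℕ} (hn : Odd n) :
    ∃ F : ↥(W.sha ⊓ AddSubgroup.torsionBy W.galH1 n) →+
        ↥(W.twoIsogenyCodomain.sha ⊓ AddSubgroup.torsionBy W.twoIsogenyCodomain.galH1 n),
      Function.Injective F := by
  obtain ⟨g, hg⟩ := exists_isogeny_twoIsogeny_comp_eq_two_nsmul W
  exact exists_shaTorsion_injective_of_comp_eq_smul W.twoIsogeny g.toAddMonoidHom g.equivariant
    (d := 2) (fun P => by rw [natCast_zsmul]; exact hg P) (Nat.coprime_two_right.mpr hn)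

end Transfer

/-! ### Kramer's `2`-isogeny `A → B` and `Ш(A)[n] ↪ Ш(B)[n]` for odd `n` -/

section KramerIsogeny

variable {K : Type u} [Field K] [NumberField K]

/-- **`(1, 0, −½, 0) • A = A' : y² = x³ + (8m + ¼) x² + m(16m+1) x`**, the two-torsion normal
form of Kramer's `A : y² + xy = x³ + 8m x² + m(16m+1) x`: the substitution `y = y' − x/2` kills
`a₁ = 1` (`a₂' = a₂ + ½ − ¼`); `A'` is the `4⁻²`-rescaled model (6) `y² = x³ + b₂ x² + 16 a₄ x`,
`b₂ = 1 + 32m`, of Kramer §3. [cite: SilvermanAEC2009, III.1 Table 3.1] -/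
theorem smul_kramerCurveA_eq (μ : K) :
    (⟨1, 0, -2⁻¹, 0⟩ : VariableChange K) • kramerCurveA μ =
      (⟨0, 8 * μ + 4⁻¹, 0, μ * (16 * μ + 1), 0⟩ : WeierstrassCurve K) := by
  simp only [kramerCurveA, variableChange_def, inv_one, Units.val_one]
  ext <;> dsimp only <;> ring_nf

/-- **`E₂(A') : Y² = X³ − (16m + ½) X² + X/16`**: Silverman's codomain
`Y² = X³ − 2aX² + (a² − 4b)X` of the `2`-isogeny of `A' : y² = x³ + ax² + bx`, `a = 8m + ¼`,
`b = m(16m+1)`, `a² − 4b = 1/16`. [cite: SilvermanAEC2009, III.4 Example 4.5] -/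
theorem twoIsogenyCodomain_kramerCurveA_nf (μ : K) :
    (⟨0, 8 * μ + 4⁻¹, 0, μ * (16 * μ + 1), 0⟩ : WeierstrassCurve K).twoIsogenyCodomain =
      ⟨0, -(16 * μ) - 2⁻¹, 0, 16⁻¹, 0⟩ := by
  simp only [twoIsogenyCodomain]
  ext <;> dsimp only <;> ring_nf

/-- **`(1, −¼, −½, ⅛) • B = E₂(A')`**: Kramer's `B : y² + xy = x³ − 16m x² − 8m x − m` becomes
`Y² = X³ − (16m + ½)X² + X/16` under `x = X − ¼`, `y = Y − X/2 + ⅛`, which moves the rational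
`2`-torsion point `(−¼, ⅛)` of `B` ("the only point of order 2 in `B(ℚ)` on the model (1)",
Kramer Lemma 3) to `(0, 0)`. So `B ≅ E₂(A')` over the ground field and `A → A' → E₂(A') ≅ B` is
Kramer's `2`-isogeny `f` of (12). [cite: Kramer1983, §5 (12) and Lemma 3] -/
theorem smul_kramerCurveB_eq (μ : K) :
    (⟨1, -4⁻¹, -2⁻¹, 8⁻¹⟩ : VariableChange K) • kramerCurveB μ =
      ⟨0, -(16 * μ) - 2⁻¹, 0, 16⁻¹, 0⟩ := by
  simp only [kramerCurveB, variableChange_def, inv_one, Units.val_one]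
  ext <;> dsimp only <;> ring_nf

/-- `A' : y² = x³ + (8m + ¼) x² + m(16m+1) x` is an elliptic curve for `m ≠ 0`,
`16m + 1 ≠ 0`: `Δ(A') = 16 b²(a² − 4b) = m²(16m+1)²` (`= Δ_A`). [cite: Kramer1983, §5 (11)] -/
theorem isElliptic_kramerCurveA_nf {μ : K} (h0 : μ ≠ 0) (h1 : 16 * μ + 1 ≠ 0) :
    (⟨0, 8 * μ + 4⁻¹, 0, μ * (16 * μ + 1), 0⟩ : WeierstrassCurve K).IsElliptic := by
  rw [isElliptic_iff, Δ_of_isTwoTorsionNF, isUnit_iff_ne_zero]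
  have h16 : (16 : K) ≠ 0 := by norm_num
  have ha₂ : (8 * μ + 4⁻¹) ^ 2 - 4 * (μ * (16 * μ + 1)) = (16⁻¹ : K) := by
    field_simp
    ring
  change 16 * (μ * (16 * μ + 1)) ^ 2 * ((8 * μ + 4⁻¹) ^ 2 - 4 * (μ * (16 * μ + 1))) ≠ 0
  rw [ha₂]
  exact mul_ne_zero (mul_ne_zero h16 (pow_ne_zero _ (mul_ne_zero h0 h1))) (inv_ne_zero h16)

/-- **`Ш(A/K)[n] ↪ Ш(B/K)[n]` for Kramer's curves `A = kramerCurveA m`, `B = kramerCurveB m`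
over a number field `K` (`m ≠ 0`, `16m + 1 ≠ 0`) and odd `n`**: compose `A ≅ A'`
(`exists_shaTorsion_injective_smul`), Silverman's `2`-isogeny `A' → E₂(A')`
(`exists_shaTorsion_injective_twoIsogeny`) and `E₂(A') ≅ B`
(`exists_shaTorsion_injective_of_smul`). This is "The isogeny `f : A → B` induces an
isomorphism `Ш(A/K)[n] ≅ Ш(B/K)[n]` since the degree of `f` is prime to `n`" (Matsuno, p. 459)
in the injective direction that the proof of Theorem 5.1 uses.
[cite: Matsuno2009, §5 (p. 459)] -/
theorem exists_shaTorsion_injective_kramerCurveA_to_B {μ : K} (h0 : μ ≠ 0)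
    (h1 : 16 * μ + 1 ≠ 0) {n : ℕ} (hn : Odd n) :
    ∃ F : ↥((kramerCurveA μ).sha ⊓ AddSubgroup.torsionBy (kramerCurveA μ).galH1 n) →+
        ↥((kramerCurveB μ).sha ⊓ AddSubgroup.torsionBy (kramerCurveB μ).galH1 n),
      Function.Injective F := by
  haveI := isElliptic_kramerCurveA_nf h0 h1
  have e₁ := exists_shaTorsion_injective_smul (kramerCurveA μ) ⟨1, 0, -2⁻¹, 0⟩ n
  rw [smul_kramerCurveA_eq] at e₁
  have e₂ := exists_shaTorsion_injective_twoIsogeny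
    (⟨0, 8 * μ + 4⁻¹, 0, μ * (16 * μ + 1), 0⟩ : WeierstrassCurve K) hn
  rw [twoIsogenyCodomain_kramerCurveA_nf, ← smul_kramerCurveB_eq μ] at e₂
  have e₃ := exists_shaTorsion_injective_of_smul (kramerCurveB μ) ⟨1, -4⁻¹, -2⁻¹, 8⁻¹⟩ n
  obtain ⟨F₁, hF₁⟩ := e₁
  obtain ⟨F₂, hF₂⟩ := e₂
  obtain ⟨F₃, hF₃⟩ := e₃
  exact ⟨F₃.comp (F₂.comp F₁), hF₃.comp (hF₂.comp hF₁)⟩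

/-- **`Ш(A_K/K)[n] ↪ Ш(B_K/K)[n]` for the base changes to a number field `K` of Kramer's curves
`A = kramerCurveA m`, `B = kramerCurveB m` over `ℚ`** (`m ≥ 1` an integer, `n` odd) — the form
consumed by the assembly of Matsuno's Theorem 5.1 (`A_K = kramerCurveA (m : K)` by
`map_kramerCurveA`). [cite: Matsuno2009, §5 (p. 459)] -/
theorem exists_shaTorsion_injective_kramer_baseChange (K : Type u) [Field K] [NumberField K]
    {M : ℕ} (hM : 0 < M) {n : ℕ} (hn : Odd n) :
    ∃ F : ↥(((kramerCurveA (M : ℚ)).baseChange K).sha ⊓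
          AddSubgroup.torsionBy ((kramerCurveA (M : ℚ)).baseChange K).galH1 n) →+
        ↥(((kramerCurveB (M : ℚ)).baseChange K).sha ⊓
          AddSubgroup.torsionBy ((kramerCurveB (M : ℚ)).baseChange K).galH1 n),
      Function.Injective F := by
  have hA : (kramerCurveA (M : ℚ)).baseChange K = kramerCurveA (M : K) := by
    rw [baseChange, map_kramerCurveA, map_natCast]
  have hB : (kramerCurveB (M : ℚ)).baseChange K = kramerCurveB (M : K) := by
    rw [baseChange, map_kramerCurveB, map_natCast]
  rw [hA, hB]
  have h0 : (M : K) ≠ 0 := Nat.cast_ne_zero.mpr hM.ne'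
  have h1 : 16 * (M : K) + 1 ≠ 0 := by
    have : ((16 * M + 1 : ℕ) : K) ≠ 0 := Nat.cast_ne_zero.mpr (by omega)
    push_cast at this
    exact this
  exact exists_shaTorsion_injective_kramerCurveA_to_B h0 h1 hn

end KramerIsogeny

end Literature.NumberTheory.EllipticCurves

end
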